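import Summits.Ventures.HSemireg.MethodInstanceG6ThetaSecantReachCertificates
import Mathlib.NumberTheory.LegendreSymbol.QuadraticReciprocity
import HarnessLib

/-!
# Venture HSemireg — REACH BY QUADRATIC SYMBOLS for the g = 6 theta-secant method instance: the two-prime law for `d = p·q`
# (`p ≡ 1`, `q ≡ 3 (mod 4)` primes): `(p/q) = −1` ⟹ `ℚ(√-pq)` reached; `p ≡ 5 (mod 8)` ∧ `(p/q) = +1` ⟹ NOT reached — no Pell data either way

HONEST FRAMING. Lean index of the computation cell `pub-hsemireg` (seat p8, «Sunday typer § g = 6»; sequel of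
`MethodInstanceG6ThetaSecantReachCertificates.lean`). ELEMENTARY NUMBER THEORY only (2-descent on `x² − d·y² = 1` read through quadratic
residues; Mathlib's quadratic reciprocity and its supplements); no variety, sheaf or `Ext` group is constructed and no Weil-class statement is
made in this file. Nothing here says HC, HC_CM or HC_AV is proved; the reach concerns SPLIT sixfold components (method instances; the verdict's
deciding rows stay «NO-in-families-tried», candidates 0). «Reached» keeps the predecessors' ℕ-currency `∃ m k, m even ∧ m² = d·k² + 1` (`ℚ(√-d)` =
the field of the theta-secant parameter `m`; REACH LAW: ⟺ the fundamental solution of `x² − d·y² = 1` has `y` odd).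

WHAT IT ADDS. The predecessors decide each single `d` by a YES witness or a NO certificate (`a·b = d`, `1 < b`, `b·v² = a·u² + 1`) and prove ONE
infinite family, «every prime `p ≡ 3 (mod 4)` is reached». Here the next family, products of TWO primes, is decided by quadratic symbols:
* §1 THE EVEN DESCENT (`pell_two_certificate_of_even_x`, `thetaSecant_two_certificate_of_reach`): a solution with `x` EVEN splits
  `(x − 1)(x + 1) = d·y²` (coprime odd factors) as `x − 1 = a·u²`, `x + 1 = b·v²`, `a·b = d` — a certificate `b·v² − a·u² = 2`, the companion of the
  predecessor's odd descent `b·v² − a·u² = 1` (no minimality needed on this side).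
* §2 RESIDUES READ OFF A CERTIFICATE `b·v² = a·u² + c`: for a prime `ℓ ∣ a` the class `c·b` is a square mod `ℓ`, for `ℓ ∣ b` the class `−c·a` is
  (`isSquare_mul_of_certificate_of_dvd_left`, `isSquare_neg_mul_of_certificate_of_dvd_right`); divisors of `p·q` (`eq_of_mul_eq_two_primes`).
* §3 THE LOCAL OBSTRUCTION CRITERION (`thetaSecant_reach_of_local_obstruction`: every factorisation `d = a·b`, `1 < b`, obstructed modulo some `ℓ` ⟹
  reached) and THE TWO-PRIME LAW, `d = p·q`, `p ≡ 1 (mod 4)`, `q ≡ 3 (mod 4)` primes (so `d ≡ 3 (mod 4)`): (a) a NO certificate necessarily has `(a, b) = (q, p)`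
  and makes `p` a square mod `q` (`thetaSecant_certificate_shape_two_primes`: `(1, pq)` would make `−1` a square mod `q`; `(p, q)` would make `q` a
  square mod `p` — i.e. `p` one mod `q`, reciprocity — and `−p` a square mod `q`, so `−1` one; `(pq, 1)` has `b = 1`); hence **`(p/q) = −1` ⟹ `ℚ(√-pq)`
  IS REACHED** (`thetaSecant_reaches_two_primes_of_not_isSquare`, symbol form `…_of_legendreSym_eq_neg_one`) — `15, 35, 51, 87, 91, 115, 119, 123, 143,
  159, 187, 215, 235, 247, 267, 287, 303, 319, 335, 339, 391, …`, 21 of the 28 composite YES rows below `400`; (b) on the `= 2` side: if `p ≡ 5 (mod 8)`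
  (neither `2` nor `−2` a square mod `p`) and `q` is a square mod `p`, all four factorisations of the even descent are obstructed ⟹ **NO even `m`:
  `ℚ(√-pq)` is NOT reached** (`thetaSecant_noReach_two_primes_of_five_mod_eight`, `thetaSecant_noList_…`), with no certificate — this alone explains
  ALL fourteen NO rows below `400` (`39 = 13·3, 55 = 5·11, …, 395 = 5·79`: each has `p ≡ 5 (mod 8)`, `(q/p) = +1`; sequel file); (c) together, for
  `p ≡ 5 (mod 8)`: **REACHED ⟺ `(q/p) = −1`** (`thetaSecant_reach_two_primes_iff_of_five_mod_eight`, `…_iff_legendreSym`).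
The residue-class families (`3p`, `5q`), the honest limit at `p ≡ 1 (mod 8)` (`219` reached vs `579` not: the symbols decide nothing there), the table to
`d < 400` with the census count «68 of 82», and the composition with the landed Weil-class theorem are in the sequel
`MethodInstanceG6ThetaSecantReachSymbolsTable.lean`. The number theory is classical (Legendre/Dirichlet-type descents `p·v² − q·u² = ±1, ±2` decided by
`(−1/·)`, `(±2/·)`, `(p/q)`); proved here in full: 0 `def`, 0 `sorry`, 0 named fact. Source of the reach sentence: `step0/THETA-SECANT-p1.md` v2.6 §1
«COVERAGE (Pell)»; census `target-g6/CENSUS.md` row D-2 REACH cell.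
-/

noncomputable section

open CategoryTheory AlgebraicGeometry
open Literature.AlgebraicGeometry.Motives Literature.AlgebraicGeometry.HodgeTheory
open Literature.AlgebraicGeometry.ModuliOfAbelianVarieties Literature.AlgebraicGeometry.Deligne1982
open Literature.AlgebraicGeometry.KTheory
open Literature.AlgebraicTopology.SingularHomology

namespace Summit.Ventures.HSemireg

section EvenDescent

open Pell

/-! ## §1 The even descent: `x` even ⟹ `b·v² − a·u² = 2`, `a·b = d` -/

/-- **EVEN DESCENT.** For odd `d > 0` and a solution `x² − d·y² = 1` with `x` EVEN and positive: `(x − 1)·(x + 1) = d·y²` with `x ± 1` odd and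
coprime, so `x − 1 = a·u²`, `x + 1 = b·v²` along `a = gcd(x − 1, d)`, `a·b = d` — a certificate `b·v² − a·u² = 2` (companion of
`pell_certificate_of_odd_fundamental_x`; no minimality is used). [bookkeeping] -/
theorem pell_two_certificate_of_even_x {d x y : ℤ} (hd0 : 0 < d) (hx : Even x) (hx0 : 0 < x) (hxy : x ^ 2 - d * y ^ 2 = 1) :
    ∃ a b u v : ℤ, a * b = d ∧ 0 < a ∧ 0 < b ∧ b * v ^ 2 - a * u ^ 2 = 2 := by
  obtain ⟨j, hj⟩ := hx
  obtain ⟨s, hs⟩ : ∃ s : ℤ, s = x - 1 := ⟨_, rfl⟩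
  have hsj : s = 2 * j - 1 := by omega
  have hs0 : 0 < s := by omega
  have key : s * (s + 2) = d * y ^ 2 := by
    rw [show x = s + 1 by omega] at hxy
    linear_combination hxy
  obtain ⟨g, s', b, hg0, hcop, hs', hb'⟩ := Int.exists_gcd_one' (Int.gcd_pos_of_ne_zero_right s hd0.ne')
  have hg0' : (0 : ℤ) < g := by exact_mod_cast hg0
  have hcop' : IsCoprime s' b := Int.isCoprime_iff_gcd_eq_one.2 hcop
  have hb0 : 0 < b := by
    have : 0 < b * (g : ℤ) := by rw [← hb']; exact hd0
    by_contra hle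
    push Not at hle
    nlinarith
  have hs'0 : 0 < s' := by
    have : 0 < s' * (g : ℤ) := by rw [← hs']; exact hs0
    by_contra hle
    push Not at hle
    nlinarith
  have key' : s' * (s + 2) = b * y ^ 2 := by
    have e : (g : ℤ) * (s' * (s + 2)) = g * (b * y ^ 2) := by
      calc (g : ℤ) * (s' * (s + 2)) = s * (s + 2) := by rw [hs']; ring
        _ = d * y ^ 2 := key
        _ = g * (b * y ^ 2) := by rw [hb']; ring
    exact mul_left_cancel₀ hg0'.ne' e
  obtain ⟨r, hr⟩ : b ∣ s + 2 := hcop'.symm.dvd_of_dvd_mul_left ⟨y ^ 2, key'⟩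
  have hprod : s' * r = y ^ 2 := by
    have e : b * (s' * r) = b * y ^ 2 := by rw [← key', hr]; ring
    exact mul_left_cancel₀ hb0.ne' e
  have hcopsr : IsCoprime s' r := by
    have h0 : IsCoprime (s' * (g : ℤ)) (b * r) := by
      rw [← hs', ← hr]
      exact ⟨-(j + 1), j, by rw [hsj]; ring⟩
    exact h0.of_mul_left_left.of_mul_right_right
  obtain ⟨u, hu⟩ := Int.sq_of_isCoprime hcopsr hprod
  obtain ⟨v, hv⟩ := Int.sq_of_isCoprime hcopsr.symm (by rw [mul_comm]; exact hprod)
  have hsu : s' = u ^ 2 := by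
    rcases hu with hu | hu
    · exact hu
    · nlinarith [sq_nonneg u]
  have hr0 : 0 < r := by
    have : 0 < b * r := by rw [← hr]; omega
    by_contra hle
    push Not at hle
    nlinarith
  have hrv : r = v ^ 2 := by
    rcases hv with hv | hv
    · exact hv
    · nlinarith [sq_nonneg v]
  refine ⟨g, b, u, v, by rw [hb', mul_comm], hg0', hb0, ?_⟩
  rw [← hrv, ← hsu]
  linear_combination (-1 : ℤ) * hr + hs'

/-- **ℕ-currency.** For odd `d`: an EVEN `m` with `m² = d·k² + 1` (a reaching theta-secant parameter) yields `a·b = d` and `b·v² = a·u² + 2` in ℕ.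
[bookkeeping] -/
theorem thetaSecant_two_certificate_of_reach {d m k : ℕ} (hd : Odd d) (hm : Even m) (hmk : m ^ 2 = d * k ^ 2 + 1) :
    ∃ a b u v : ℕ, a * b = d ∧ b * v ^ 2 = a * u ^ 2 + 2 := by
  have hm0 : 0 < m := by
    rcases Nat.eq_zero_or_pos m with rfl | h
    · simp at hmk
    · exact h
  obtain ⟨a, b, u, v, hab, ha, hb, hc⟩ := pell_two_certificate_of_even_x (d := (d : ℤ)) (by exact_mod_cast hd.pos)
    ((Int.even_coe_nat m).2 hm) (by exact_mod_cast hm0) (pell_prop_of_nat hmk)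
  refine ⟨a.natAbs, b.natAbs, u.natAbs, v.natAbs, ?_, ?_⟩
  · have : ((a.natAbs * b.natAbs : ℕ) : ℤ) = (d : ℤ) := by push_cast; rw [abs_of_pos ha, abs_of_pos hb, hab]
    exact_mod_cast this
  · have : ((b.natAbs * v.natAbs ^ 2 : ℕ) : ℤ) = ((a.natAbs * u.natAbs ^ 2 + 2 : ℕ) : ℤ) := by
      push_cast
      rw [abs_of_pos ha, abs_of_pos hb, sq_abs, sq_abs]
      linarith
    exact_mod_cast this

end EvenDescent

section Symbols

/-! ## §2 Quadratic residues read off a certificate `b·v² = a·u² + c` -/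

/-- **`ℓ ∣ a` ⟹ `c·b` is a square mod `ℓ`** (`b·v² ≡ c`, so `c·b ≡ (b·v)²`). [bookkeeping] -/
theorem isSquare_mul_of_certificate_of_dvd_left {ℓ a b u v c : ℕ} (hl : ℓ ∣ a) (h : b * v ^ 2 = a * u ^ 2 + c) :
    IsSquare ((c : ZMod ℓ) * b) := by
  have ha : ((a : ℕ) : ZMod ℓ) = 0 := (ZMod.natCast_eq_zero_iff a ℓ).2 hl
  have h' : ((b : ℕ) : ZMod ℓ) * (v : ZMod ℓ) ^ 2 = c := by
    have e := congrArg (Nat.cast : ℕ → ZMod ℓ) h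
    push_cast at e
    rw [ha, zero_mul, zero_add] at e
    exact e
  exact ⟨(b : ZMod ℓ) * v, by rw [← h']; ring⟩

/-- **`ℓ ∣ b` ⟹ `−c·a` is a square mod `ℓ`** (`a·u² ≡ −c`, so `−c·a ≡ (a·u)²`). [bookkeeping] -/
theorem isSquare_neg_mul_of_certificate_of_dvd_right {ℓ a b u v c : ℕ} (hl : ℓ ∣ b) (h : b * v ^ 2 = a * u ^ 2 + c) :
    IsSquare (-(c : ZMod ℓ) * a) := by
  have hb : ((b : ℕ) : ZMod ℓ) = 0 := (ZMod.natCast_eq_zero_iff b ℓ).2 hl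
  have h' : ((a : ℕ) : ZMod ℓ) * (u : ZMod ℓ) ^ 2 = -c := by
    have e := congrArg (Nat.cast : ℕ → ZMod ℓ) h
    push_cast at e
    rw [hb, zero_mul] at e
    exact eq_neg_of_add_eq_zero_left e.symm
  exact ⟨(a : ZMod ℓ) * u, by linear_combination (-(a : ZMod ℓ)) * h'⟩

/-- In a field: `x·y` and `y ≠ 0` squares ⟹ `x` a square (`x = (x·y)/y`). [bookkeeping] -/
theorem isSquare_of_isSquare_mul_right {F : Type*} [Field F] {x y : F} (hxy : IsSquare (x * y)) (hy : IsSquare y) (hy0 : y ≠ 0) :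
    IsSquare x := by
  rw [← mul_div_cancel_right₀ x hy0]
  exact hxy.div hy

/-- **Divisors of a product of two distinct primes**: `a·b = p·q` ⟹ `(a, b) ∈ {(1, pq), (p, q), (q, p), (pq, 1)}`. [bookkeeping] -/
theorem eq_of_mul_eq_two_primes {p q a b : ℕ} (hp : p.Prime) (hq : q.Prime) (hpq : p ≠ q) (hab : a * b = p * q) :
    (a = 1 ∧ b = p * q) ∨ (a = p ∧ b = q) ∨ (a = q ∧ b = p) ∨ (a = p * q ∧ b = 1) := by
  have hpq0 : 0 < p * q := Nat.mul_pos hp.pos hq.pos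
  have hcop : Nat.Coprime p q := (Nat.coprime_primes hp hq).2 hpq
  have hpd : p ∣ a * b := hab ▸ dvd_mul_right p q
  have hqd : q ∣ a * b := hab ▸ dvd_mul_left q p
  rcases (Nat.Prime.dvd_mul hp).1 hpd with hpa | hpb <;> rcases (Nat.Prime.dvd_mul hq).1 hqd with hqa | hqb
  · obtain ⟨c, hc⟩ := Nat.Coprime.mul_dvd_of_dvd_of_dvd hcop hpa hqa
    have h1 : c * b = 1 := by
      refine Nat.eq_of_mul_eq_mul_left hpq0 ?_
      calc p * q * (c * b) = a * b := by rw [hc]; ring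
        _ = p * q := hab
        _ = p * q * 1 := (mul_one _).symm
    refine Or.inr (Or.inr (Or.inr ⟨?_, Nat.eq_one_of_mul_eq_one_left h1⟩))
    rw [hc, Nat.eq_one_of_mul_eq_one_right h1, mul_one]
  · obtain ⟨a', rfl⟩ := hpa
    obtain ⟨b', rfl⟩ := hqb
    have h1 : a' * b' = 1 := by
      refine Nat.eq_of_mul_eq_mul_left hpq0 ?_
      calc p * q * (a' * b') = p * a' * (q * b') := by ring
        _ = p * q := hab
        _ = p * q * 1 := (mul_one _).symm
    refine Or.inr (Or.inl ⟨?_, ?_⟩)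
    · rw [Nat.eq_one_of_mul_eq_one_right h1, mul_one]
    · rw [Nat.eq_one_of_mul_eq_one_left h1, mul_one]
  · obtain ⟨b', rfl⟩ := hpb
    obtain ⟨a', rfl⟩ := hqa
    have h1 : a' * b' = 1 := by
      refine Nat.eq_of_mul_eq_mul_left hpq0 ?_
      calc p * q * (a' * b') = q * a' * (p * b') := by ring
        _ = p * q := hab
        _ = p * q * 1 := (mul_one _).symm
    refine Or.inr (Or.inr (Or.inl ⟨?_, ?_⟩))
    · rw [Nat.eq_one_of_mul_eq_one_right h1, mul_one]
    · rw [Nat.eq_one_of_mul_eq_one_left h1, mul_one]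
  · obtain ⟨c, hc⟩ := Nat.Coprime.mul_dvd_of_dvd_of_dvd hcop hpb hqb
    have h1 : a * c = 1 := by
      refine Nat.eq_of_mul_eq_mul_left hpq0 ?_
      calc p * q * (a * c) = a * b := by rw [hc]; ring
        _ = p * q := hab
        _ = p * q * 1 := (mul_one _).symm
    refine Or.inl ⟨Nat.eq_one_of_mul_eq_one_right h1, ?_⟩
    rw [hc, Nat.eq_one_of_mul_eq_one_left h1, mul_one]

end Symbols

section TwoPrimes

open Pell

/-! ## §3 The two-prime law: `d = p·q`, `p ≡ 1 (mod 4)`, `q ≡ 3 (mod 4)` -/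

/-- `p ≡ 1`, `q ≡ 3 (mod 4)` ⟹ `p·q ≡ 3 (mod 4)` (the cell's case; odd, non-square). [bookkeeping] -/
theorem two_primes_mod_four {p q : ℕ} (hp4 : p % 4 = 1) (hq4 : q % 4 = 3) : p * q % 4 = 3 := by
  rw [Nat.mul_mod, hp4, hq4]

/-- **LOCAL OBSTRUCTION CRITERION (any `d ≡ 3 (mod 4)`).** If every factorisation `d = a·b` with `1 < b` is OBSTRUCTED modulo some `ℓ` — an `ℓ ∣ a`
with `b` not a square mod `ℓ`, or an `ℓ ∣ b` with `−a` not a square mod `ℓ` (`ℓ` need not be prime) — then no NO certificate exists, so `ℚ(√-d)` is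
reached (§2 + the predecessors' «reach ⟺ no certificate»). The two-prime law below is the case `d = p·q`; for a prime `d = p` the only factorisation
`(1, p)` is obstructed by `−1` mod `p` (the predecessors' prime theorem). [bookkeeping] -/
theorem thetaSecant_reach_of_local_obstruction {d : ℕ} (hd : d % 4 = 3)
    (h : ∀ a b : ℕ, a * b = d → 1 < b →
      (∃ ℓ : ℕ, ℓ ∣ a ∧ ¬ IsSquare ((b : ℕ) : ZMod ℓ)) ∨ (∃ ℓ : ℕ, ℓ ∣ b ∧ ¬ IsSquare (-((a : ℕ) : ZMod ℓ)))) :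
    ∃ m k : ℕ, Even m ∧ m ^ 2 = d * k ^ 2 + 1 := by
  refine (thetaSecant_reach_iff_no_certificate_of_mod_four_eq_three hd).2 ?_
  rintro ⟨a, b, u, v, hab, hb, hcert⟩
  rcases h a b hab hb with ⟨ℓ, hl, hns⟩ | ⟨ℓ, hl, hns⟩
  · have hsq := isSquare_mul_of_certificate_of_dvd_left hl hcert
    simp only [Nat.cast_one, one_mul] at hsq
    exact hns hsq
  · have hsq := isSquare_neg_mul_of_certificate_of_dvd_right hl hcert
    simp only [Nat.cast_one, neg_mul, one_mul] at hsq
    exact hns hsq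

/-- **SHAPE OF A NO CERTIFICATE for `d = p·q`** (`p ≡ 1`, `q ≡ 3 (mod 4)` primes): `a·b = p·q`, `1 < b`, `b·v² = a·u² + 1` force `(a, b) = (q, p)`
and `p` a square mod `q`. (`(1, pq)`: `u² ≡ −1 (mod q)`, impossible for `q ≡ 3 (mod 4)`; `(p, q)`: `q·v² ≡ 1 (mod p)` makes `q` a square mod `p`,
i.e. `p` a square mod `q` by reciprocity (`p ≡ 1 (mod 4)`), while `p·u² ≡ −1 (mod q)` makes `−p` one — then `−1` is a square mod `q`, impossible;
`(pq, 1)`: `b = 1`.) [bookkeeping] -/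
theorem thetaSecant_certificate_shape_two_primes {p q : ℕ} (hp : p.Prime) (hq : q.Prime) (hp4 : p % 4 = 1) (hq4 : q % 4 = 3)
    {a b u v : ℕ} (hab : a * b = p * q) (hb : 1 < b) (hcert : b * v ^ 2 = a * u ^ 2 + 1) :
    a = q ∧ b = p ∧ IsSquare ((p : ℕ) : ZMod q) := by
  haveI := Fact.mk hp
  haveI := Fact.mk hq
  have hpq : p ≠ q := by
    rintro rfl
    omega
  have hq2 : q ≠ 2 := by
    rintro rfl
    omega
  rcases eq_of_mul_eq_two_primes hp hq hpq hab with ⟨ha, hb⟩ | ⟨ha, hb⟩ | ⟨ha, hb⟩ | ⟨ha, hb⟩ <;> subst a b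
  · -- `(1, pq)`: `−1` would be a square mod `q`
    have h := isSquare_neg_mul_of_certificate_of_dvd_right (ℓ := q) (dvd_mul_left q p) hcert
    simp only [Nat.cast_one, mul_one] at h
    exact absurd hq4 (ZMod.exists_sq_eq_neg_one_iff.1 h)
  · -- `(p, q)`: `q` a square mod `p` (⟹ `p` a square mod `q`) and `−p` a square mod `q` ⟹ `−1` a square mod `q`
    have h₁ := isSquare_mul_of_certificate_of_dvd_left (ℓ := p) (dvd_refl p) hcert
    simp only [Nat.cast_one, one_mul] at h₁
    have h₂ := isSquare_neg_mul_of_certificate_of_dvd_right (ℓ := q) (dvd_refl q) hcert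
    simp only [Nat.cast_one] at h₂
    have hp' : IsSquare ((p : ℕ) : ZMod q) := (ZMod.exists_sq_eq_prime_iff_of_mod_four_eq_one hp4 hq2).1 h₁
    have hp0 : ((p : ℕ) : ZMod q) ≠ 0 := by
      rw [Ne, ZMod.natCast_eq_zero_iff]
      exact fun h ↦ hpq ((Nat.prime_dvd_prime_iff_eq hq hp).1 h).symm
    have hneg : IsSquare (-1 : ZMod q) := by
      have e : (-1 : ZMod q) = (-1 * (p : ZMod q)) * (p : ZMod q) / ((p : ZMod q) * (p : ZMod q)) := by
        field_simp
      rw [e]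
      exact (h₂.mul hp').div ⟨(p : ZMod q), rfl⟩
    exact absurd hq4 (ZMod.exists_sq_eq_neg_one_iff.1 hneg)
  · -- `(q, p)`: `p·v² ≡ 1 (mod q)`
    have h := isSquare_mul_of_certificate_of_dvd_left (ℓ := q) (dvd_refl q) hcert
    simp only [Nat.cast_one, one_mul] at h
    exact ⟨rfl, rfl, h⟩
  · -- `(pq, 1)`
    exact absurd hb (lt_irrefl 1)

/-- **NO CERTIFICATE when `(p/q) = −1`** (`p` not a square mod `q`). [bookkeeping] -/
theorem thetaSecant_no_certificate_two_primes_of_not_isSquare {p q : ℕ} (hp : p.Prime) (hq : q.Prime) (hp4 : p % 4 = 1)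
    (hq4 : q % 4 = 3) (hnsq : ¬ IsSquare ((p : ℕ) : ZMod q)) :
    ¬ ∃ a b u v : ℕ, a * b = p * q ∧ 1 < b ∧ b * v ^ 2 = a * u ^ 2 + 1 := by
  rintro ⟨a, b, u, v, hab, hb, hcert⟩
  exact hnsq (thetaSecant_certificate_shape_two_primes hp hq hp4 hq4 hab hb hcert).2.2

/-- **THE TWO-PRIME REACH THEOREM.** `p ≡ 1 (mod 4)`, `q ≡ 3 (mod 4)` primes with `p` NOT a square mod `q` (`(p/q) = −1`): some EVEN `m` and ODD `k`
satisfy `m² = p·q·k² + 1` — `ℚ(√-pq)` IS REACHED by the theta-secant family, with no Pell computation (reach ⟺ no certificate,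
`thetaSecant_reach_iff_no_certificate_of_mod_four_eq_three`, + the shape theorem). Instances: `15, 35, 51, 87, 91, 115, 119, 123, 143, 159, 187, 215, …`.
[bookkeeping] -/
theorem thetaSecant_reaches_two_primes_of_not_isSquare {p q : ℕ} (hp : p.Prime) (hq : q.Prime) (hp4 : p % 4 = 1) (hq4 : q % 4 = 3)
    (hnsq : ¬ IsSquare ((p : ℕ) : ZMod q)) : ∃ m k : ℕ, Even m ∧ Odd k ∧ m ^ 2 = p * q * k ^ 2 + 1 := by
  obtain ⟨m, k, hm, hmk⟩ := (thetaSecant_reach_iff_no_certificate_of_mod_four_eq_three (two_primes_mod_four hp4 hq4)).2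
    (thetaSecant_no_certificate_two_primes_of_not_isSquare hp hq hp4 hq4 hnsq)
  exact ⟨m, k, hm, Nat.odd_iff.2 (mod_four_eq_three_of_even_of_pell hm hmk).2, hmk⟩

/-- **Symbol form**: `(p/q) = −1` (Mathlib `legendreSym q p = -1`) ⟹ `ℚ(√-pq)` reached. [bookkeeping] -/
theorem thetaSecant_reaches_two_primes_of_legendreSym_eq_neg_one {p q : ℕ} [Fact p.Prime] [Fact q.Prime] (hp4 : p % 4 = 1)
    (hq4 : q % 4 = 3) (h : legendreSym q p = -1) : ∃ m k : ℕ, Even m ∧ Odd k ∧ m ^ 2 = p * q * k ^ 2 + 1 :=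
  thetaSecant_reaches_two_primes_of_not_isSquare Fact.out Fact.out hp4 hq4 ((legendreSym.eq_neg_one_iff' q).1 h)

/-- **NOT REACHED when `p ≡ 5 (mod 8)` and `q` is a square mod `p`** (`p`, `q` distinct primes, `q` odd): NO even `m` has `m² = p·q·k² + 1`. The even
descent `b·v² = a·u² + 2`, `a·b = p·q` is obstructed in all four cases — `(1, pq)`: `−2` a square mod `p`; `(pq, 1)`: `2` a square mod `p`;
`(p, q)`: `2q`, hence `2`, a square mod `p`; `(q, p)`: `−2q`, hence `−2`, a square mod `p` — and `p ≡ 5 (mod 8)` admits neither `2` nor `−2`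
(second supplement). [bookkeeping] -/
theorem thetaSecant_noReach_two_primes_of_five_mod_eight {p q : ℕ} (hp : p.Prime) (hq : q.Prime) (hpq : p ≠ q) (hq2 : q ≠ 2)
    (hp8 : p % 8 = 5) (hsq : IsSquare ((q : ℕ) : ZMod p)) {m k : ℕ} (hmk : m ^ 2 = p * q * k ^ 2 + 1) : ¬ Even m := by
  intro hm
  haveI := Fact.mk hp
  have hp2 : p ≠ 2 := by
    rintro rfl
    omega
  have hq0 : ((q : ℕ) : ZMod p) ≠ 0 := by
    rw [Ne, ZMod.natCast_eq_zero_iff]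
    exact fun h ↦ hpq ((Nat.prime_dvd_prime_iff_eq hp hq).1 h)
  have hodd : Odd (p * q) := (hp.odd_of_ne_two hp2).mul (hq.odd_of_ne_two hq2)
  have two_nsq : ¬ IsSquare (2 : ZMod p) := by
    rw [ZMod.exists_sq_eq_two_iff hp2]
    omega
  have negtwo_nsq : ¬ IsSquare (-2 : ZMod p) := by
    rw [ZMod.exists_sq_eq_neg_two_iff hp2]
    omega
  obtain ⟨a, b, u, v, hab, hc⟩ := thetaSecant_two_certificate_of_reach hodd hm hmk
  rcases eq_of_mul_eq_two_primes hp hq hpq hab with ⟨ha, hb⟩ | ⟨ha, hb⟩ | ⟨ha, hb⟩ | ⟨ha, hb⟩ <;> subst a b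
  · have h := isSquare_neg_mul_of_certificate_of_dvd_right (ℓ := p) (dvd_mul_right p q) hc
    simp only [Nat.cast_ofNat, Nat.cast_one, mul_one] at h
    exact negtwo_nsq h
  · have h := isSquare_mul_of_certificate_of_dvd_left (ℓ := p) (dvd_refl p) hc
    simp only [Nat.cast_ofNat] at h
    exact two_nsq (isSquare_of_isSquare_mul_right h hsq hq0)
  · have h := isSquare_neg_mul_of_certificate_of_dvd_right (ℓ := p) (dvd_refl p) hc
    simp only [Nat.cast_ofNat] at h
    exact negtwo_nsq (isSquare_of_isSquare_mul_right h hsq hq0)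
  · have h := isSquare_mul_of_certificate_of_dvd_left (ℓ := p) (dvd_mul_right p q) hc
    simp only [Nat.cast_ofNat, Nat.cast_one, mul_one] at h
    exact two_nsq h

/-- **… so in the cell's currency `¬ Even m ∧ Even k` for every solution**, and a NO certificate EXISTS (by the predecessors' dichotomy) — for
`p ≡ 5 (mod 8)`, `q ≡ 3 (mod 4)`, `q` a square mod `p`. [bookkeeping] -/
theorem thetaSecant_noList_two_primes_of_five_mod_eight {p q : ℕ} (hp : p.Prime) (hq : q.Prime) (hp8 : p % 8 = 5) (hq4 : q % 4 = 3)
    (hsq : IsSquare ((q : ℕ) : ZMod p)) {m k : ℕ} (hmk : m ^ 2 = p * q * k ^ 2 + 1) : ¬ Even m ∧ Even k := by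
  have hpq : p ≠ q := by
    rintro rfl
    omega
  have hq2 : q ≠ 2 := by
    rintro rfl
    omega
  have hd : p * q % 4 = 3 := two_primes_mod_four (by omega) hq4
  have hodd : Odd (p * q) := Nat.odd_iff.2 (Nat.odd_of_mod_four_eq_three hd)
  rcases thetaSecant_reach_or_certificate hodd (not_isSquare_of_mod_four_eq_three hd) with ⟨m', k', hm', hmk'⟩ | ⟨a, b, u, v, hab, hb, hcert⟩
  · exact absurd hm' (thetaSecant_noReach_two_primes_of_five_mod_eight hp hq hpq hq2 hp8 hsq hmk')
  · exact thetaSecant_noReach_of_certificate hodd hab hb hcert hmk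

/-- **THE COMPLETE LAW for `p ≡ 5 (mod 8)`**, `q ≡ 3 (mod 4)` primes: `ℚ(√-pq)` is reached ⟺ `q` is NOT a square mod `p` (`(q/p) = −1`;
⟸ by the reach theorem and reciprocity, ⟹ by the obstruction). [bookkeeping] -/
theorem thetaSecant_reach_two_primes_iff_of_five_mod_eight {p q : ℕ} (hp : p.Prime) (hq : q.Prime) (hp8 : p % 8 = 5) (hq4 : q % 4 = 3) :
    (∃ m k : ℕ, Even m ∧ m ^ 2 = p * q * k ^ 2 + 1) ↔ ¬ IsSquare ((q : ℕ) : ZMod p) := by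
  haveI := Fact.mk hp
  haveI := Fact.mk hq
  have hq2 : q ≠ 2 := by
    rintro rfl
    omega
  constructor
  · rintro ⟨m, k, hm, hmk⟩ hsq
    exact (thetaSecant_noList_two_primes_of_five_mod_eight hp hq hp8 hq4 hsq hmk).1 hm
  · intro hnsq
    have hnsq' : ¬ IsSquare ((p : ℕ) : ZMod q) := by
      rwa [← ZMod.exists_sq_eq_prime_iff_of_mod_four_eq_one (p := p) (q := q) (by omega) hq2]
    obtain ⟨m, k, hm, -, hmk⟩ := thetaSecant_reaches_two_primes_of_not_isSquare hp hq (by omega) hq4 hnsq'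
    exact ⟨m, k, hm, hmk⟩

/-- **Symbol form of the complete law**: for `p ≡ 5 (mod 8)`, `q ≡ 3 (mod 4)`: reached ⟺ `legendreSym p q = -1` (`(q/p) = −1`). [bookkeeping] -/
theorem thetaSecant_reach_two_primes_iff_legendreSym {p q : ℕ} [Fact p.Prime] [Fact q.Prime] (hp8 : p % 8 = 5) (hq4 : q % 4 = 3) :
    (∃ m k : ℕ, Even m ∧ m ^ 2 = p * q * k ^ 2 + 1) ↔ legendreSym p q = -1 := by
  rw [legendreSym.eq_neg_one_iff' p]
  exact thetaSecant_reach_two_primes_iff_of_five_mod_eight Fact.out Fact.out hp8 hq4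

end TwoPrimes

/-! ## Audit: nothing is decided here
KERNEL: §1 the even 2-descent (`x` even ⟹ `b·v² − a·u² = 2`, `a·b = d`), §2 residues read off certificates and the divisors of `p·q`, §3 the two-prime
law — shape of a NO certificate; `(p/q) = −1` ⟹ reached; `p ≡ 5 (mod 8)` ∧ `(q/p) = +1` ⟹ not reached; the complete law for `p ≡ 5 (mod 8)`, in
residue and in Legendre-symbol form. No named hypothesis, no Weil-class statement (compose via the sequel / `MethodInstanceG6ThetaSecantReachLaw.lean`
§5; their tier: reach + `PerfectComplexRankTransfer` BY NAME, m-uniform seed BY VALUE). Not here: `p ≡ 1 (mod 8)` with `(p/q) = +1` (undecided by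
quadratic symbols — sequel, `219` vs `579`), three or more prime factors, any non-split sixfold, HC_CM, `σ ∘ ob = ⌟ch`. -/

end Summit.Ventures.HSemireg

end
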